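import Mathlib
import Summits.KontsevichZagierPeriods.Zeta5Search.BrickHatMultiplier

/-!
# BrickHatLocality — zi-p2's THEOREM 9 LEMMA 9.2 (iv) for the OFF-DIGIT cells `K = jp + i` of the row `np`:
Wilson-block DIGIT-LOCALITY of the unit multiplier, `Λ°_{K'} ≡ Λ°_K (mod p^e)` for blocks `j'p = jp + p^e·q`, `e ≥ 1`
— with `e = 1`, ANY two blocks (cell zeta5-irr)

HONEST FRAMING: systematic search; no irrationality claim unless certified. INSTRUMENT lemmas of the ζ(5)
census cell zeta5-irr (HOME `run/shared/lean/pub/zeta5-irr/`; memo `zi-p2/probes/B8/thm9/THEOREM9.md` (sealed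
eae326393abac726) LEMMA 9.2 «(iv) Λ°_{K*} ≡ Λ°_K (mod p^{e+1}) for K* = K + p^{e+1}t … Each of K*!_p/K!_p, (np−K)!_p/(np−K*)!_p,
(np+K*)!_p/(np+K)!_p, (2np−K)!_p/(2np−K*)!_p is the product of the prime-to-p integers in t consecutive blocks of p^{e+1}
consecutive integers, hence ≡ (−1)^t (mod p^{e+1}) by (W) … (the signs cancel in pairs …), and (np−2K*)/2 = (np−2K)/2 −
p^{e+1}t»; the same argument works for blocks of length `p`, i.e. depth one, which is how it is used in LEMMA 9.3 here).
Nothing here is about ζ(5); no irrationality content; filing moves no rung. Filed by the engine seat zi-eng (g10); the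
hole-digit twin of `BrickLambdaLocality` on the closed form `BrickHatMultiplier.hatLam_mul_unitPart`.

## The statements (digits `i + i' = p`, `1 ≤ i, i'`; blocks `J + M = J' + M' = m`, `J'p = Jp + p^e·q`, `e ≥ 1`)

* `hatParts_zmod_eq`: `Û_{K'} = Û_K` and `Ŷ_{K'} = Ŷ_K` in `ZMod (p^e)` (`BrickLambdaLocality.sub_shift` for the block shift);
* **`hatLam_local`**, **`hatLam_local_std`** (`A` even, `p` odd, `2B ≤ A`): `v(Λ°_{K'} − Λ°_K) ≤ exp(−e)`.
-/

namespace Summit.KontsevichZagierPeriods.Zeta5Search.BrickHatLocality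

open Finset Nat WithZero
open Summit.KontsevichZagierPeriods.Zeta5Search.BrickLambda (padicValuation_two)
open Summit.KontsevichZagierPeriods.Zeta5Search.GaussWilsonBlock (unitFactorial unitFactorial_shift_iter)
open Summit.KontsevichZagierPeriods.Zeta5Search.BrickLambdaLocality (padicValuation_sub_le_of_zmod_eq sub_shift)
open Summit.KontsevichZagierPeriods.Zeta5Search.BrickResidueLawMain (cong_mul_le)
open Summit.KontsevichZagierPeriods.Zeta5Search.BrickHatMultiplier (hatLam hatUnitPart hatGainPart
  hatLam_mul_unitPart padicValuation_hatUnitPart padicValuation_hatGainPart)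
open Literature.NumberTheory.LFunctions (padicValuation_natCast_le_one)

variable {p : ℕ} [Fact p.Prime]

/-! ## LEMMA 9.2 (iv): Wilson-block locality -/

section locality

variable (hp2 : p ≠ 2) {A B i i' J M J' M' e q : ℕ} (hJM : J' + M' = J + M) (hq : J' * p = J * p + p ^ e * q)
  (he : 1 ≤ e)
include hp2 hJM hq he

/-- **The unit and gained parts agree mod `p^e`**: `Û_{K'} ≡ Û_K` and `Ŷ_{K'} ≡ Ŷ_K` (each unit factorial moves by
`p^e·q`; the signs `(−1)^q` of the Wilson blocks cancel in pairs). -/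
theorem hatParts_zmod_eq :
    (hatUnitPart p A B i i' J' M' : ZMod (p ^ e)) = (hatUnitPart p A B i i' J M : ZMod (p ^ e)) ∧
      (hatGainPart p A B i i' J' M' : ZMod (p ^ e)) = (hatGainPart p A B i i' J M : ZMod (p ^ e)) := by
  have hp : p.Prime := Fact.out
  have h3 : 3 ≤ p := by have := hp.two_le; omega
  have hMq := sub_shift (p := p) hJM hq
  have s1 : (unitFactorial p (i + J' * p) : ZMod (p ^ e)) = (-1) ^ q * unitFactorial p (i + J * p) := by
    rw [show i + J' * p = (i + J * p) + p ^ e * q by rw [add_assoc, ← hq], unitFactorial_shift_iter p e _ q hp h3 he]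
  have s2 : (unitFactorial p (i' + M * p) : ZMod (p ^ e)) = (-1) ^ q * unitFactorial p (i' + M' * p) := by
    rw [show i' + M * p = (i' + M' * p) + p ^ e * q by rw [add_assoc, ← hMq], unitFactorial_shift_iter p e _ q hp h3 he]
  have s3 : (unitFactorial p ((J + M + 1) * p + (i + J' * p)) : ZMod (p ^ e)) =
      (-1) ^ q * unitFactorial p ((J + M + 1) * p + (i + J * p)) := by
    rw [show (J + M + 1) * p + (i + J' * p) = ((J + M + 1) * p + (i + J * p)) + p ^ e * q by rw [hq]; ring,
      unitFactorial_shift_iter p e _ q hp h3 he]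
  have s4 : (unitFactorial p (i' + M * p + (J + M + 1) * p) : ZMod (p ^ e)) =
      (-1) ^ q * unitFactorial p (i' + M' * p + (J + M + 1) * p) := by
    rw [show i' + M * p + (J + M + 1) * p = (i' + M' * p + (J + M + 1) * p) + p ^ e * q by rw [hMq]; ring,
      unitFactorial_shift_iter p e _ q hp h3 he]
  unfold hatUnitPart hatGainPart
  rw [hJM]
  push_cast
  rw [s1, s2, s3, s4]
  constructor <;> ring

include hp2 in
/-- **LEMMA 9.2 (iv), DIGIT-LOCALITY of `Λ°`** (`A` even, `p` odd, `2B ≤ A`): for the off-digit cells `K = i + Jp` and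
`K' = i + J'p` of the row `np` (`n = J + M + 1 = J' + M' + 1`, digits `i + i' = p`) with `J'p = Jp + p^e·q`, `e ≥ 1`:
`v(Λ°_{K'} − Λ°_K) ≤ exp(−e)`. With `e = 1` this holds for ANY two blocks. -/
theorem hatLam_local (hA : Even A) (hAB : 2 * B ≤ A) (hii : i + i' = p) (hi : 1 ≤ i) (hi' : 1 ≤ i') :
    Rat.padicValuation p (hatLam A B p (J + M) J' i - hatLam A B p (J + M) J i) ≤ exp (-(e : ℤ)) := by
  have hp : p.Prime := Fact.out
  have hL := hatLam_mul_unitPart (p := p) hp2 hA hAB hii hi hi' (J := J) (M := M)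
  have hL' := hatLam_mul_unitPart (p := p) hp2 hA hAB hii hi hi' (J := J') (M := M')
  rw [hJM] at hL'
  set c : ℚ := ((((J + M + 1) * p : ℕ) : ℚ) / 2 - ((i + J * p : ℕ) : ℚ)) with hc
  set c' : ℚ := ((((J + M + 1) * p : ℕ) : ℚ) / 2 - ((i + J' * p : ℕ) : ℚ)) with hc'
  have vU := padicValuation_hatUnitPart (p := p) A B i i' J M
  have vU' := padicValuation_hatUnitPart (p := p) A B i i' J' M'
  have hU0 : (hatUnitPart p A B i i' J M : ℚ) ≠ 0 := fun h => by rw [h, map_zero] at vU; exact zero_ne_one vU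
  have hU'0 : (hatUnitPart p A B i i' J' M' : ℚ) ≠ 0 := fun h => by rw [h, map_zero] at vU'; exact zero_ne_one vU'
  have vUU : Rat.padicValuation p ((hatUnitPart p A B i i' J M : ℚ) - hatUnitPart p A B i i' J' M') ≤ exp (-(e : ℤ)) := by
    rw [Valuation.map_sub_swap]; exact padicValuation_sub_le_of_zmod_eq (hatParts_zmod_eq hp2 hJM hq he).1
  have vYY : Rat.padicValuation p ((hatGainPart p A B i i' J' M' : ℚ) - hatGainPart p A B i i' J M) ≤ exp (-(e : ℤ)) :=
    padicValuation_sub_le_of_zmod_eq (hatParts_zmod_eq hp2 hJM hq he).2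
  have hcen : ∀ x : ℕ, Rat.padicValuation p (((((J + M + 1) * p : ℕ) : ℚ)) / 2 - (x : ℚ)) ≤ 1 := by
    intro x
    rw [show ((((J + M + 1) * p : ℕ) : ℚ)) / 2 - (x : ℚ) = (((((J + M + 1) * p : ℕ) : ℤ) - 2 * x : ℤ) : ℚ) / 2
      by push_cast; ring, map_div₀, padicValuation_two hp2, div_one, Rat.padicValuation_cast]
    exact Int.padicValuation_le_one _ _
  have hc1 : Rat.padicValuation p c ≤ 1 := by rw [hc]; exact_mod_cast hcen (i + J * p)
  have hcc : Rat.padicValuation p (c' - c) ≤ exp (-(e : ℤ)) := by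
    have : c' - c = -((p : ℚ) ^ e * q) := by
      have hq' : ((i + J' * p : ℕ) : ℚ) = ((i + J * p : ℕ) : ℚ) + (p : ℚ) ^ e * q := by
        exact_mod_cast (by rw [hq]; ring : i + J' * p = i + J * p + p ^ e * q)
      rw [hc, hc', hq']; ring
    rw [this, Valuation.map_neg, map_mul, map_pow, Rat.padicValuation_self, ← exp_nsmul, nsmul_eq_mul, mul_neg_one]
    calc _ ≤ exp (-(e : ℤ)) * 1 := mul_le_mul' le_rfl (padicValuation_natCast_le_one q)
      _ = _ := mul_one _
  have hlamq : hatLam A B p (J + M) J i = c * (hatGainPart p A B i i' J M : ℚ) / hatUnitPart p A B i i' J M := by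
    rw [eq_div_iff hU0, hL]
  have hlamq' : hatLam A B p (J + M) J' i = c' * (hatGainPart p A B i i' J' M' : ℚ) / hatUnitPart p A B i i' J' M' := by
    rw [eq_div_iff hU'0, hL']
  rw [hlamq', hlamq, div_sub_div _ _ hU'0 hU0, map_div₀, map_mul, vU, vU', mul_one, div_one,
    show c' * (hatGainPart p A B i i' J' M' : ℚ) * hatUnitPart p A B i i' J M -
        hatUnitPart p A B i i' J' M' * (c * (hatGainPart p A B i i' J M : ℚ)) =
      c' * (hatGainPart p A B i i' J' M' : ℚ) * hatUnitPart p A B i i' J M -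
        c * (hatGainPart p A B i i' J M : ℚ) * hatUnitPart p A B i i' J' M' by ring]
  refine cong_mul_le (cong_mul_le hcc vYY ?_ (padicValuation_natCast_le_one _)) vUU ?_ (padicValuation_natCast_le_one _)
  · rw [hc']; exact_mod_cast hcen (i + J' * p)
  · rw [map_mul]
    exact mul_le_one' (by rw [hc']; exact_mod_cast hcen (i + J' * p)) (padicValuation_natCast_le_one _)

end locality

/-- **LEMMA 9.2 (iv) in standard digit form**: row `np`, `n = m + 1`, off-digit cells `K = i + jp`, `K' = i + j'p` with
`1 ≤ i ≤ p − 1`, `j, j' ≤ m`, `j'p = jp + p^e·q`, `e ≥ 1`; `A` even, `p` odd, `2B ≤ A`: `v(Λ°_{K'} − Λ°_K) ≤ exp(−e)`. -/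
theorem hatLam_local_std (hp2 : p ≠ 2) {A B m j j' i e q : ℕ} (hA : Even A) (hAB : 2 * B ≤ A) (hi : 1 ≤ i)
    (hip : i < p) (hj : j ≤ m) (hj' : j' ≤ m) (hq : j' * p = j * p + p ^ e * q) (he : 1 ≤ e) :
    Rat.padicValuation p (hatLam A B p m j' i - hatLam A B p m j i) ≤ exp (-(e : ℤ)) := by
  obtain ⟨M, rfl⟩ := Nat.exists_eq_add_of_le hj
  obtain ⟨M', hM'⟩ := Nat.exists_eq_add_of_le hj'
  exact hatLam_local hp2 hM'.symm hq he hA hAB (i' := p - i) (by omega) hi (by omega)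

end Summit.KontsevichZagierPeriods.Zeta5Search.BrickHatLocality
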